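import Summits.BirchSwinnertonDyer.BirchSwinnertonDyer.Theorems.ManinLocalTwoThreeManinPrimeToAdditiveFiveLeStarredTwinOfTwistAdditive
import Summits.BirchSwinnertonDyer.BirchSwinnertonDyer.Theses.TwistFamilyManinDescent
import HarnessLib

/-!
# Route `ManinLocalTwoThree`, residual crux C5 `ManinPrimeToAdditiveFiveLe`
# (stmt-BirchSwinnertonDyer-22969), line `upper_anchor` (skeleton v11, registered stub `stub_ord57` :=
# `TwistFamilyManinDescent.OrdinaryCornerManinResidual`, stmt-BirchSwinnertonDyer-27552, BY NAME):
# **the potentially-ORDINARY reducible residue at `p ∈ {5, 7}` is HALVED modulo E-imc-9 — 27552 ⟸ its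
# STARRED rows ∧ `OrdinaryRamifiedTwistLaw 5` ∧ `OrdinaryRamifiedTwistLaw 7`**

Width seat bsd-line-ml23-c5-p1-w3 (gen 0), piece χ (part 2/2; part 1 = `…StarredTwinOfTwistAdditive.lean`, the
twin packet on 27552's own binders). Since skeleton v11 (lead gen 6, 2026-08-28T11:27Z) the line `upper_anchor`
is a pure by-name assembly and its potentially-ordinary content is the ONE registered stub `stub_ord57` =
`OrdinaryCornerManinResidual` (route `TwistFamilyManinDescent`, stmt-27552): Manin's `p ∤ c(D)` for a globally
minimal `W` with a lattice-optimal datum at a level `N` with `p² ∣ N`, `p ∈ {5, 7}`, `W[p]` reducible, `W ⊗ p*`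
additive at `(p)`, on the rows `(5; III/III*)`, `(7; II/IV/IV*/II*)` (`(p; ord_p Δ_min) ∈ {(5;3),(5;9),(7;2),
(7;4),(7;8),(7;10)}`; the potentially supersingular rows `(5;4,8)`, `(7;3,9)` and the row `(5;2,10)` excluded).
Census (`Cruxes/…/LEDGER-upper-anchor.md` gen 4): these rows pair up into 377 + 112 + 43 COMMUTING `χ_{p*}`-orbits
`(5;III) ↔ (5;III*)`, `(7;II) ↔ (7;IV*)`, `(7;IV) ↔ (7;II*)`, degree up by `p` from the unstarred end, all `c = 1`.

THIS FILE proves, kernel-checked: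

* §1 `ordinaryCorner_unstarredRow` — row bookkeeping: under 27552's exclusions an additive fibre with
  `ord_p Δ_min ≤ 4` is `(5;3)`, `(7;2)` or `(7;4)` (Ogg–Tate).
* §2 `ordinaryCornerManinResidual_of_starredRows_of_ordinaryRamifiedTwistLaws` —
  **`OrdinaryCornerManinResidual` BY NAME ⟸ (the same statement with ONE extra binder `4 < ord_p Δ_min(W)`, i.e.
  restricted to its STARRED rows `(5; III*)`, `(7; IV*)`, `(7; II*)`) ∧ E-imc-9 at `5` and `7`.** On an unstarred
  row the χ-packet (`exists_commuting_starred_twin_of_twistAdditive_of_ordinaryRamifiedTwistLaw`: potential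
  ordinarity DISCHARGED from `e ∣ p − 1`; trichotomy cases (ii)/(iii) killed by E-imc-9; near-invariance) produces
  the commuting lattice-optimal starred twin `(W₀, D₀)` with `v_p c(D₀) = v_p c(D)`, to which the starred-row
  hypothesis applies (`W₀[p]` reducible by twist/isogeny invariance; `W₀ ⊗ p* ∼ W` additive at `(p)`; level =
  conductor by modularity).

NET READING for the planners (cell bsd-f2-manin -imc; route TwistFamilyManinDescent pens bsd-idea-3): modulo the
imc cell's registered conjecture E-imc-9 `OrdinaryRamifiedTwistLaw` at `5` and `7` (REF1 SURVIVES; 85 108 / 85 108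
exact ratio `p` in range), the node 27552 — and with it the whole potentially-ordinary `W[p]`-reducible content of
C5 at `p ≤ 7` — is ONE Manin statement per commuting orbit, readable on the STARRED end: `(5; III*)` (`e = 4 =
p − 1`), `(7; IV*)` (`e = 3 < p − 1`, Raynaud-admissible: Edixhoven's Prop. 7 mechanism), `(7; II*)` (`e = 6 =
p − 1`). (The unstarred-end reading is θ, p617914/p617000.) Compare route TwistFamilyManinDescent's own cut
K18a/K18b/K18t of the same node: K18b `OrdinaryCornerUnstarredNotBottom` («no case 1 on the unstarred rows») is
the Manin-side shadow of E-imc-9's degree clause.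

HONEST STATUS. Conditional result (`--supports` the C5 crux as a helper): E-imc-9 is an OPEN conjecture (not in
print); the starred rows of 27552 are OPEN (no method in print at `e = p − 1`; a port of Edixhoven's Prop. 7 at
`(7; IV*)`). Nothing here proves 27552, C5, E-imc-9, Manin's conjecture or BSD. No summit statement is proved.

References: [EdixhovenManin1991] Thm. 3, Prop. 7, §4; [SilvermanATAEC1994] IV Table 4.1; [ZagierCMB1985] §1;
[DiamondShurman2005] Thm. 8.8.3; cell bsd-f2-manin MEMO-imc.md §10 (E-imc-9); route TwistFamilyManinDescent
thesis (LINE 17/18: 27552, K18a stmt-27557, K18b stmt-27558, K18t stmt-27559).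
-/

set_option autoImplicit false
-- the Theorems namespace of this sub repeats the summit name by design (D-0017 nested layout)
set_option linter.dupNamespace false

noncomputable section

open scoped Classical NumberField

namespace Summit.BirchSwinnertonDyer.BirchSwinnertonDyer.Theorems

open WeierstrassCurve IsDedekindDomain IsDedekindDomain.HeightOneSpectrum Rat.HeightOneSpectrum NumberField
  Literature.NumberTheory.EllipticCurves Literature.NumberTheory.EllipticCurves.ModularForms
  Literature.NumberTheory.EllipticCurves.Rank1Residual
  Literature.NumberTheory.DiophantineGeometry
  Summit.BirchSwinnertonDyer.Rank1Residual.ManinAdditive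
  Summit.BirchSwinnertonDyer.Rank1Residual.Additive

/-! ## §1 Row bookkeeping: the unstarred potentially-ordinary rows of `OrdinaryCornerManinResidual` -/

/-- **The unstarred rows of 27552.** At `p ∈ {5, 7}`, additive, `ord_p Δ_min ≤ 4`, off the potentially
supersingular rows `(5; 4, 8)`, `(7; 3, 9)` and off `(5; 2, 10)`: `(p; ord_p Δ_min) ∈ {(5;3), (7;2), (7;4)}`
(Ogg–Tate). [cite: SilvermanATAEC1994, IV Table 4.1] -/
theorem ordinaryCorner_unstarredRow (W : WeierstrassCurve ℚ) [W.IsElliptic] [W.IsGloballyMinimal] (p : ℕ)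
    [Fact p.Prime] (h57 : p = 5 ∨ p = 7) (hadd : Addv W p) (hv : padicValInt p W.minimalDiscriminantInt ≤ 4)
    (hnotSS : ¬ ((p = 5 ∧ padicValInt 5 W.minimalDiscriminantInt ∈ ({4, 8} : Finset ℕ)) ∨
      (p = 7 ∧ padicValInt 7 W.minimalDiscriminantInt ∈ ({3, 9} : Finset ℕ))))
    (hnot5II : ¬ (p = 5 ∧ padicValInt 5 W.minimalDiscriminantInt ∈ ({2, 10} : Finset ℕ))) :
    (p = 5 ∧ padicValInt p W.minimalDiscriminantInt = 3) ∨ (p = 7 ∧ padicValInt p W.minimalDiscriminantInt = 2) ∨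
      (p = 7 ∧ padicValInt p W.minimalDiscriminantInt = 4) := by
  have h5 : 5 ≤ p := by rcases h57 with rfl | rfl <;> norm_num
  rcases kodairaSymbolAt_placeOf_cases_of_addv W p h5 hadd with
    ⟨-, hv'⟩ | ⟨-, hv'⟩ | ⟨-, hv'⟩ | ⟨n, -, hv'⟩ | ⟨-, hv'⟩ | ⟨-, hv'⟩ | ⟨-, hv'⟩
  · rcases h57 with rfl | rfl
    · exact absurd ⟨rfl, by rw [hv']; decide⟩ hnot5II
    · exact Or.inr (Or.inl ⟨rfl, hv'⟩)
  · rcases h57 with rfl | rfl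
    · exact Or.inl ⟨rfl, hv'⟩
    · exact absurd (Or.inr ⟨rfl, by rw [hv']; decide⟩) hnotSS
  · rcases h57 with rfl | rfl
    · exact absurd (Or.inl ⟨rfl, by rw [hv']; decide⟩) hnotSS
    · exact Or.inr (Or.inr ⟨rfl, hv'⟩)
  all_goals omega

/-! ## §2 `OrdinaryCornerManinResidual` (27552) ⟸ its STARRED rows ∧ E-imc-9(5) ∧ E-imc-9(7) -/

/-- **`TwistFamilyManinDescent.OrdinaryCornerManinResidual` (stmt-BirchSwinnertonDyer-27552, the declared
potentially-ORDINARY residual of the `W[p]`-reducible Manin problem at `p ∈ {5, 7}`; since skeleton v10 the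
BY-NAME owner of the upper_anchor line's stubs `stub_red7ordIV` / `stub_red57corner` via -w2's υ5) ⟸ ITS OWN
STARRED ROWS (`hStar` = the same statement with the extra binder `4 < ord_p Δ_min(W)`, i.e. the rows
`(5; III*)`, `(7; IV*)`, `(7; II*)`) ∧ E-imc-9 `OrdinaryRamifiedTwistLaw` at `5` and `7`.** On a starred row
`hStar` applies as is. On an unstarred row (`(5;3)`, `(7;2)`, `(7;4)` by §1; tame index `4 ∣ 4`, `6 ∣ 6`,
`3 ∣ 6`) the χ-packet (`exists_commuting_starred_twin_of_twistAdditive_of_ordinaryRamifiedTwistLaw`; potential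
ordinarity discharged, `N = N(W)` by modularity) gives the commuting lattice-optimal starred twin `(W₀, D₀)` with
`v_p c(D₀) = v_p c(D)` on the row `(5;9)` / `(7;8)` / `(7;10)`; `W₀[p]` is reducible (twist/isogeny
invariance) and `W₀ ⊗ p* ∼ W` is additive at `(p)`; so `hStar` gives `p ∤ c(D₀)` and `p ∤ c(D)`. NET: modulo the
imc cell's E-imc-9 the node 27552 is ONE Manin statement per commuting orbit, readable on the starred end.
Conditional result (`--supports` the C5 crux as a helper); closes nothing; 27552, C5, E-imc-9 are NOT proved.
[cite: EdixhovenManin1991, Thm. 3 and §4] [cite: SilvermanATAEC1994, IV Table 4.1] [cite: ZagierCMB1985, §1] -/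
theorem ordinaryCornerManinResidual_of_starredRows_of_ordinaryRamifiedTwistLaws
    (hStar : mazur_not_dvd_maninConstant_of_odd → abbesUllmo_not_dvd_maninConstant_of_not_dvd_level →
      cesnavicius_not_two_dvd_maninConstant_of_two_dvd_level → exists_isNewformOf →
      ∀ (W : WeierstrassCurve ℚ) [W.IsElliptic] [W.IsGloballyMinimal] {N : ℕ} [NeZero N]
        (D : ModularParametrizationData W N) (p : ℕ) (hp : p.Prime), (p = 5 ∨ p = 7) →
        ¬ ((p = 5 ∧ padicValInt 5 W.minimalDiscriminantInt ∈ ({4, 8} : Finset ℕ)) ∨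
            (p = 7 ∧ padicValInt 7 W.minimalDiscriminantInt ∈ ({3, 9} : Finset ℕ))) →
        ¬ (p = 5 ∧ padicValInt 5 W.minimalDiscriminantInt ∈ ({2, 10} : Finset ℕ)) →
        p ^ 2 ∣ N → ¬ W.HasIrreducibleModPGaloisRep p →
        ¬ ((W.quadraticTwist (((-1 : ℤ) ^ (p / 2) * p : ℤ) : ℚ)).HasGoodReductionAt
              ((Rat.HeightOneSpectrum.primesEquiv (R := ℤ)).symm ⟨p, hp⟩) ∨
            (W.quadraticTwist (((-1 : ℤ) ^ (p / 2) * p : ℤ) : ℚ)).HasMultiplicativeReductionAt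
              ((Rat.HeightOneSpectrum.primesEquiv (R := ℤ)).symm ⟨p, hp⟩)) →
        4 < padicValInt p W.minimalDiscriminantInt →
        (∀ z ∈ D.L.lattice, ∃ w ∈ periodLattice D.f, z = D.c * w) →
        ¬ (p : ℤ) ∣ D.maninConstant)
    (hO5 : OrdinaryRamifiedTwistLaw 5) (hO7 : OrdinaryRamifiedTwistLaw 7) :
    Summit.BirchSwinnertonDyer.BirchSwinnertonDyer.Theses.TwistFamilyManinDescent.OrdinaryCornerManinResidual := by
  intro hM hAU hC hnf W _ _ N _ D p hp h57 hnotSS hnot5II hpN hred htwadd hD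
  haveI hpF : Fact p.Prime := ⟨hp⟩
  by_cases hv : 4 < padicValInt p W.minimalDiscriminantInt
  · exact hStar hM hAU hC hnf W D p hp h57 hnotSS hnot5II hpN hred htwadd hv hD
  push Not at hv
  -- level = conductor (modularity)
  obtain rfl : N = W.conductorNorm ℤ :=
    IsNewformOf.level_eq_conductorNorm_of_exists_isNewformOf hnf D.isNewformOf
  have h5 : 5 ≤ p := by rcases h57 with rfl | rfl <;> norm_num
  have hp2 : p ≠ 2 := by omega
  have hO : OrdinaryRamifiedTwistLaw p := by
    rcases h57 with rfl | rfl
    · exact hO5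
    · exact hO7
  have hadd : Addv W p := not_good_and_not_mult_of_sq_dvd_conductorNorm W hpN
  have hrow := ordinaryCorner_unstarredRow W p h57 hadd hv hnotSS hnot5II
  have he : 12 / Nat.gcd 12 (padicValInt p W.minimalDiscriminantInt) ∣ p - 1 := by
    rcases hrow with ⟨rfl, h⟩ | ⟨rfl, h⟩ | ⟨rfl, h⟩ <;> rw [h] <;> decide
  obtain ⟨W₀, hE₀, hM₀, hne₀, u, D₀, hD₀, -, -, htw, -, hpN₀, -, hc, hΔ⟩ :=
    exists_commuting_starred_twin_of_twistAdditive_of_ordinaryRamifiedTwistLaw hnf hp h5 hO W D hD hpN htwadd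
      hv he
  haveI := hE₀
  haveI := hM₀
  haveI := hne₀
  have hd0 : ((((-1 : ℤ) ^ (p / 2) * p : ℤ)) : ℚ) ≠ 0 := by
    push_cast
    exact mul_ne_zero (pow_ne_zero _ (by norm_num)) (by exact_mod_cast hp.ne_zero)
  haveI : (W₀.quadraticTwist ((((-1 : ℤ) ^ (p / 2) * p : ℤ)) : ℚ)).IsElliptic := W₀.isElliptic_quadraticTwist hd0
  -- the hypotheses of `hStar` for the twin `(W₀, D₀)` on the row `(p; ord_p Δ_min + 6)`
  have hred₀ : ¬ W₀.HasIrreducibleModPGaloisRep p := fun h ↦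
    not_hasIrreducibleModPGaloisRep_of_isIsogenous htw hred
      ((hasIrreducibleModPGaloisRep_quadraticTwist_iff W₀ hd0 p).mpr h)
  have htwadd₀ := twist_pStar_additiveAt_of_isIsogenous_twist_pStar_of_sq_dvd hnf hp htw hpN
  have hv₀ : 4 < padicValInt p W₀.minimalDiscriminantInt := by omega
  have hnotSS₀ : ¬ ((p = 5 ∧ padicValInt 5 W₀.minimalDiscriminantInt ∈ ({4, 8} : Finset ℕ)) ∨
      (p = 7 ∧ padicValInt 7 W₀.minimalDiscriminantInt ∈ ({3, 9} : Finset ℕ))) := by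
    rcases hrow with ⟨rfl, h⟩ | ⟨rfl, h⟩ | ⟨rfl, h⟩ <;> rw [h] at hΔ <;>
      rintro (⟨hp', hm⟩ | ⟨hp', hm⟩) <;> first | omega | (rw [hΔ] at hm; revert hm; decide)
  have hnot5II₀ : ¬ (p = 5 ∧ padicValInt 5 W₀.minimalDiscriminantInt ∈ ({2, 10} : Finset ℕ)) := by
    rcases hrow with ⟨rfl, h⟩ | ⟨rfl, h⟩ | ⟨rfl, h⟩ <;> rw [h] at hΔ <;>
      rintro ⟨hp', hm⟩ <;> first | omega | (rw [hΔ] at hm; revert hm; decide)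
  have hnd : ¬ (p : ℤ) ∣ D₀.maninConstant :=
    hStar hM hAU hC hnf W₀ D₀ p hp h57 hnotSS₀ hnot5II₀ hpN₀ hred₀ htwadd₀ hv₀ hD₀
  have hv₀c : padicValInt p D₀.c = 0 := padicValInt.eq_zero_of_not_dvd hnd
  have hc0 : D.c ≠ 0 := Int.cast_ne_zero.mp D.cast_c_ne_zero
  intro hpc
  have hpc' : (p : ℤ) ^ 1 ∣ D.c := by rw [pow_one]; exact hpc
  rcases (padicValInt_dvd_iff 1 D.c).mp hpc' with h | h
  · exact hc0 h
  · omega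

end Summit.BirchSwinnertonDyer.BirchSwinnertonDyer.Theorems

end
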